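import Mathlib.Data.Fintype.Perm
import Mathlib.Data.Fintype.CardEmbedding
import Mathlib.Data.Fintype.Prod
import Mathlib.Data.Nat.Factorial.Basic
import Literature.Computability.Complexity.ClosedFamiliesIn
import Literature.Computability.Complexity.MonotoneApproximation
import HarnessLib

/-!
# Razborov's lattice for the logical permanent (Jukna 2012, §9.11): the scheme and the positive error

The approximation scheme behind Razborov's lower bound `m^{Ω(log m)}` for the monotone
complexity of the perfect matching function `f_m` of `m²` variables (A. A. Razborov, *Lower
bounds on monotone complexity of the logical permanent*, Mat. Zametki 37 (1985); S. Jukna,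
*Boolean Function Complexity* (2012), §9.11, PDF pp. 291–296), as an instance of the generic
approximation method `ApproxScheme` (`MonotoneApproximation.lean`, Jukna's Thm. 9.30) in the
lattice of `r`-closed subfamilies (`ClosedFamiliesIn.lean`, Jukna §9.10.1) of the ambient family
`Per_s` of matchings with at most `s` edges. Everything in this file is PROVED.

* `PerfectMatching.Edge m = Fin m × Fin m` (the variables `x_{i,j}` = edges of `K_{m,m}`),
  `IsMatching`, `Per m s` (Jukna: "`Per_s = {E ⊆ K_{m,m} | E is a matching and |E| ≤ s}`"),
  `card_Per_le : |Per_s| ≤ (m·m + 1)^s` (Jukna prints `m^{2s}`).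
* `Accepts 𝒜 G` — the monotone family `⌈𝒜⌉` ("all graphs containing at least one matching
  in `𝒜`") evaluated on the edge set `G`; `edgesOf x` — the edge set of an input `x`.
* `inputFamily s e` (`A(x_e) = ⌈{e}⌉` realised by the closed family of matchings through `e`),
  `scheme m r s : ApproxScheme` — `ok = r`-closed in `Per_s`, `⊔ = ` closure of the union,
  `⊓ = ∩` (Jukna, Lemma 9.31).
* Positive test inputs `permInput σ` (the perfect matching of a permutation `σ`, Jukna's `E₊`)
  and **Lemma 9.34** in counting form, `card_posErr_le`: an approximate meet of two closed
  families loses at most `((r-1)^s)^2 · (m - s - 1)!` of the `m!` perfect matchings (Jukna's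
  bound is `(s! rˢ)² (m-s-1)!/m!` with the sunflower count; we use Alon–Boppana's `(r-1)^s`),
  via `card_filter_supset_permGraph_le`: at most `(m - |E|)!` permutations contain a matching `E`.

The negative side (Jukna's random graph `E₋` of a two-colouring, Lemmas 9.35–9.37) and the
final dichotomy are in `PerfectMatchingColorings.lean`; the asymptotic choice of `r, s`
(Thm. 9.38) is in `Literature/Barriers/PneNP/MonotoneGapPerfectMatchingProofs.lean`.

## References

* S. Jukna, *Boolean Function Complexity: Advances and Frontiers*, Springer (2012), §9.10–9.11,
  Lemmas 9.31, 9.32, 9.34, Thm. 9.38 (PDF pp. 288–296) [Jukna2012].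
* A. A. Razborov, *Lower bounds on monotone complexity of the logical permanent*, Mat. Zametki
  37 (1985) 887–900 [Razborov1985b].
* N. Alon, R. B. Boppana, *The monotone circuit complexity of Boolean functions*,
  Combinatorica 7 (1987), Lemma 3.2 [AlonBoppana1987].
-/

namespace Literature.Computability.Complexity

namespace PerfectMatching

open Finset Razborov

variable {m : ℕ}

/-- The input positions of the perfect matching function `f_m`: the edges `(i, j)` of the
complete bipartite graph `K_{m,m}` (variables `x_{i,j}`). [cite: Jukna2012, §9.11 (PDF p. 291)] -/
abbrev Edge (m : ℕ) : Type := Fin m × Fin m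

/-! ### Matchings and the ambient family `Per_s` -/

/-- A set of edges of `K_{m,m}` is a **matching**: no two of its edges share a left endpoint
and no two share a right endpoint. [cite: Jukna2012, §9.11 (PDF p. 291)] -/
def IsMatching (E : Finset (Edge m)) : Prop :=
  (∀ e₁ ∈ E, ∀ e₂ ∈ E, e₁.1 = e₂.1 → e₁ = e₂) ∧ ∀ e₁ ∈ E, ∀ e₂ ∈ E, e₁.2 = e₂.2 → e₁ = e₂

/-- Being a matching is decidable (a finite conjunction). [folklore] -/
instance (E : Finset (Edge m)) : Decidable (IsMatching E) := by
  unfold IsMatching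
  exact instDecidableAnd

/-- Subsets of matchings are matchings. [folklore] -/
theorem IsMatching.subset {E F : Finset (Edge m)} (h : IsMatching E) (hFE : F ⊆ E) :
    IsMatching F :=
  ⟨fun e₁ h₁ e₂ h₂ => h.1 e₁ (hFE h₁) e₂ (hFE h₂), fun e₁ h₁ e₂ h₂ => h.2 e₁ (hFE h₁) e₂ (hFE h₂)⟩

/-- A single edge is a matching. [folklore] -/
theorem isMatching_singleton (e : Edge m) : IsMatching ({e} : Finset (Edge m)) :=
  ⟨fun e₁ h₁ e₂ h₂ _ => by rw [mem_singleton.1 h₁, mem_singleton.1 h₂],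
    fun e₁ h₁ e₂ h₂ _ => by rw [mem_singleton.1 h₁, mem_singleton.1 h₂]⟩

/-- A matching has as many left endpoints as edges. [folklore] -/
theorem IsMatching.card_image_fst {E : Finset (Edge m)} (h : IsMatching E) :
    #(E.image Prod.fst) = #E :=
  card_image_of_injOn fun e₁ h₁ e₂ h₂ heq => h.1 e₁ h₁ e₂ h₂ heq

/-- A matching has as many right endpoints as edges. [folklore] -/
theorem IsMatching.card_image_snd {E : Finset (Edge m)} (h : IsMatching E) :
    #(E.image Prod.snd) = #E :=
  card_image_of_injOn fun e₁ h₁ e₂ h₂ heq => h.2 e₁ h₁ e₂ h₂ heq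

/-- The **ambient family** `Per_s`: all matchings of `K_{m,m}` with at most `s` edges (Jukna
2012, §9.11: "`Per_s = {E ⊆ K_{m,m} | E is a matching and |E| ≤ s}`"; the empty matching is a
member). [cite: Jukna2012, §9.11 (PDF p. 291)] -/
def Per (m s : ℕ) : Finset (Finset (Edge m)) := univ.filter fun E => IsMatching E ∧ #E ≤ s

/-- Membership in `Per_s`. [cite: Jukna2012, §9.11 (PDF p. 291)] -/
@[simp] theorem mem_Per {s : ℕ} {E : Finset (Edge m)} : E ∈ Per m s ↔ IsMatching E ∧ #E ≤ s := by
  simp [Per]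

/-- `Per_s` is closed under subsets. [folklore] -/
theorem Per_down {s : ℕ} : ∀ W ∈ Per m s, ∀ U, U ⊆ W → U ∈ Per m s := fun W hW U hUW => by
  rw [mem_Per] at hW ⊢
  exact ⟨hW.1.subset hUW, (card_le_card hUW).trans hW.2⟩

/-- Members of `Per_s` have at most `s` edges. [folklore] -/
theorem card_le_of_mem_Per {s : ℕ} : ∀ W ∈ Per m s, #W ≤ s := fun _ hW => (mem_Per.1 hW).2

/-- Single edges belong to `Per_s` (`s ≥ 1`). [folklore] -/
theorem singleton_mem_Per {s : ℕ} (hs : 1 ≤ s) (e : Edge m) : ({e} : Finset (Edge m)) ∈ Per m s :=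
  mem_Per.2 ⟨isMatching_singleton e, by simpa using hs⟩

/-- **The size of the ambient family**: `|Per_s| ≤ Σ_{k ≤ s} (m² choose k) ≤ (m·m + 1)^s`
(Jukna 2012, before Lemma 9.37, prints `|Per_s| ≤ m^{2s}`; any such polynomial-in-`m^s` bound
serves). [cite: Jukna2012, §9.11.2 (PDF p. 294)] -/
theorem card_Per_le (s : ℕ) : #(Per m s) ≤ (m * m + 1) ^ s := by
  classical
  calc #(Per m s) ≤ #((range (s + 1)).biUnion fun k => powersetCard k (univ : Finset (Edge m))) := by
        refine card_le_card fun W hW => ?_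
        rw [mem_Per] at hW
        exact mem_biUnion.2 ⟨#W, mem_range.2 (Nat.lt_succ_of_le hW.2),
          mem_powersetCard.2 ⟨subset_univ _, rfl⟩⟩
    _ ≤ ∑ k ∈ range (s + 1), #(powersetCard k (univ : Finset (Edge m))) := card_biUnion_le
    _ = ∑ k ∈ range (s + 1), (m * m).choose k := by
        simp only [card_powersetCard, card_univ, Fintype.card_prod, Fintype.card_fin]
    _ ≤ ∑ k ∈ range (s + 1), (m * m) ^ k := sum_le_sum fun k _ => Nat.choose_le_pow _ _
    _ ≤ (m * m + 1) ^ s := sum_range_pow_le_succ_pow _ _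

/-! ### The monotone family `⌈𝒜⌉` of a family of matchings -/

/-- `⌈𝒜⌉` on an edge set `G`: some member of `𝒜` is contained in `G` (Jukna 2012, §9.10:
`⌈ℱ⌉ = ⋃_{F ∈ ℱ} {E | F ⊆ E}`; §9.11: "all graphs containing at least one matching in `𝒜`").
[cite: Jukna2012, §9.10 (PDF p. 289)] -/
def Accepts (A : Finset (Finset (Edge m))) (G : Finset (Edge m)) : Prop := ∃ E ∈ A, E ⊆ G

/-- `⌈𝒜⌉(G)` is decidable (a finite disjunction). [folklore] -/
instance (A : Finset (Finset (Edge m))) (G : Finset (Edge m)) : Decidable (Accepts A G) :=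
  inferInstanceAs (Decidable (∃ E ∈ A, E ⊆ G))

/-- `⌈·⌉` is monotone in the family. [folklore] -/
theorem Accepts.mono {A B : Finset (Finset (Edge m))} {G : Finset (Edge m)} (h : Accepts A G)
    (hAB : A ⊆ B) : Accepts B G := by
  obtain ⟨E, hE, hEG⟩ := h
  exact ⟨E, hAB hE, hEG⟩

/-- `⌈𝒜⌉` is a monotone family of edge sets. [cite: Jukna2012, §9.10 (PDF p. 289)] -/
theorem Accepts.supset {A : Finset (Finset (Edge m))} {G H : Finset (Edge m)} (h : Accepts A G)
    (hGH : G ⊆ H) : Accepts A H := by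
  obtain ⟨E, hE, hEG⟩ := h
  exact ⟨E, hE, hEG.trans hGH⟩

/-- `⌈𝒜 ∪ ℬ⌉ = ⌈𝒜⌉ ∪ ⌈ℬ⌉`. [cite: Jukna2012, §9.10 (PDF p. 288)] -/
theorem accepts_union_iff {A B : Finset (Finset (Edge m))} {G : Finset (Edge m)} :
    Accepts (A ∪ B) G ↔ Accepts A G ∨ Accepts B G := by
  constructor
  · rintro ⟨E, hE, hEG⟩
    rcases mem_union.1 hE with hE | hE
    · exact Or.inl ⟨E, hE, hEG⟩
    · exact Or.inr ⟨E, hE, hEG⟩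
  · rintro (h | h)
    · exact h.mono subset_union_left
    · exact h.mono subset_union_right

/-- The edge set of an input `x : K_{m,m} → {0,1}`. [folklore] -/
def edgesOf (x : Edge m → Bool) : Finset (Edge m) := univ.filter fun e => x e = true

/-- Membership in the edge set of an input. [folklore] -/
@[simp] theorem mem_edgesOf {x : Edge m → Bool} {e : Edge m} : e ∈ edgesOf x ↔ x e = true := by
  simp [edgesOf]

/-! ### The approximators of the input variables -/

/-- The approximator of the variable `x_e`: the matchings of `Per_s` through `e` — a closed
family `𝒜` with `⌈𝒜⌉ = ⌈{e}⌉ = A(x_e)` (Jukna 2012, Lemma 9.31: "`A(x_i) = ⌈{x_i}⌉`").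
[cite: Jukna2012, Lemma 9.31] -/
def inputFamily (s : ℕ) (e : Edge m) : Finset (Finset (Edge m)) := (Per m s).filter fun E => e ∈ E

/-- The input approximators are `r`-closed for `r ≥ 2` (two of the implying matchings contain
`e`, hence so does the implied one). [cite: Jukna2012, Lemma 9.31] -/
theorem isClosedIn_inputFamily {r s : ℕ} (hr : 2 ≤ r) (e : Edge m) :
    IsClosedIn r (Per m s) (inputFamily s e) := by
  refine ⟨filter_subset _ _, fun U hU hI => ?_⟩
  obtain ⟨W, hW, hWU⟩ := hI
  set i0 : Fin r := ⟨0, by omega⟩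
  set i1 : Fin r := ⟨1, by omega⟩
  have h0 := (mem_filter.1 (hW i0)).2
  have h1 := (mem_filter.1 (hW i1)).2
  have hsub := hWU i0 i1 (by simp [i0, i1, Fin.ext_iff])
  exact mem_filter.2 ⟨hU, hsub (mem_inter.2 ⟨h0, h1⟩)⟩

/-- `⌈inputFamily e⌉(G) ↔ e ∈ G` (`s ≥ 1`, so that `{e} ∈ Per_s`). [cite: Jukna2012, Lemma 9.31] -/
theorem accepts_inputFamily_iff {s : ℕ} (hs : 1 ≤ s) (e : Edge m) (G : Finset (Edge m)) :
    Accepts (inputFamily s e) G ↔ e ∈ G := by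
  constructor
  · rintro ⟨E, hE, hEG⟩
    exact hEG (mem_filter.1 hE).2
  · intro he
    exact ⟨{e}, mem_filter.2 ⟨singleton_mem_Per hs e, mem_singleton_self e⟩,
      singleton_subset_iff.2 he⟩

/-! ### The approximation scheme `𝔐_m` -/

/-- **Razborov's lattice `𝔐_m` for the logical permanent as an approximation scheme** (Jukna
2012, §9.10.1 and §9.11 with Lemma 9.31): approximators are the `r`-closed subfamilies of
`Per_s`, denoting the monotone functions `⌈𝒜⌉`; the approximate join is the closure of the
union, the approximate meet the intersection; variables are approximated exactly by
`inputFamily`. Requires `r ≥ 2` and `s ≥ 1`. [cite: Jukna2012, Lemma 9.31 and §9.11 (PDF pp. 290–292)] -/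
noncomputable def scheme (m r s : ℕ) (hr : 2 ≤ r) (hs : 1 ≤ s) :
    ApproxScheme (Edge m) (Finset (Finset (Edge m))) where
  ok A := IsClosedIn r (Per m s) A
  val A x := decide (Accepts A (edgesOf x))
  sup A B := closureIn r (Per m s) (A ∪ B)
  inf A B := A ∩ B
  inp e := inputFamily s e
  ok_inp e := isClosedIn_inputFamily hr e
  ok_sup A B _ _ := isClosedIn_closureIn r _ _
  ok_inf A B hA hB := hA.inter hB
  val_inp e x := by
    rw [Bool.eq_iff_iff, decide_eq_true_iff, accepts_inputFamily_iff hs, mem_edgesOf]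

/-- The semantics of an approximator, unfolded. [folklore] -/
theorem scheme_val_eq_true_iff {r s : ℕ} (hr : 2 ≤ r) (hs : 1 ≤ s) (A : Finset (Finset (Edge m)))
    (x : Edge m → Bool) : (scheme m r s hr hs).val A x = true ↔ Accepts A (edgesOf x) := by
  simp [scheme]

/-- **No positive loss at a join**: `⌈𝒜⌉ ∪ ⌈ℬ⌉ ⊆ ⌈(𝒜 ∪ ℬ)*⌉`, so an approximate OR never
rejects an input accepted by one of its arguments (Jukna 2012, §9.10: `M ∪ N ⊆ M ⊔ N`).
[cite: Jukna2012, §9.10 (PDF p. 289)] -/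
theorem lostSup_eq_empty {σ : Type*} {r s : ℕ} (hr : 2 ≤ r) (hs : 1 ≤ s) (P : Finset σ)
    (pt : σ → Edge m → Bool) {A B : Finset (Finset (Edge m))}
    (hA : (scheme m r s hr hs).ok A) (hB : (scheme m r s hr hs).ok B) :
    (scheme m r s hr hs).lostSup P pt A B = ∅ := by
  refine filter_false_of_mem fun z _ h => ?_
  obtain ⟨hab, hsup⟩ := h
  have hsub : A ∪ B ⊆ Per m s := union_subset hA.subset hB.subset
  rw [Bool.or_eq_true, scheme_val_eq_true_iff, scheme_val_eq_true_iff] at hab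
  have hacc : Accepts (closureIn r (Per m s) (A ∪ B)) (edgesOf (pt z)) :=
    (accepts_union_iff.2 hab).mono (subset_closureIn hsub)
  have : (scheme m r s hr hs).val ((scheme m r s hr hs).sup A B) (pt z) = true :=
    (scheme_val_eq_true_iff hr hs _ _).2 hacc
  rw [this] at hsup
  exact Bool.noConfusion hsup

/-- **No negative gain at a meet**: `⌈𝒜 ∩ ℬ⌉ ⊆ ⌈𝒜⌉ ∩ ⌈ℬ⌉`, so an approximate AND never
accepts an input rejected by one of its arguments (Jukna 2012, §9.10: `M ⊓ N ⊆ M ∩ N`).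
[cite: Jukna2012, §9.10 (PDF p. 289)] -/
theorem gainedInf_eq_empty {τ : Type*} {r s : ℕ} (hr : 2 ≤ r) (hs : 1 ≤ s) (N : Finset τ)
    (pt : τ → Edge m → Bool) (A B : Finset (Finset (Edge m))) :
    (scheme m r s hr hs).gainedInf N pt A B = ∅ := by
  refine filter_false_of_mem fun z _ h => ?_
  obtain ⟨hab, hinf⟩ := h
  have hacc : Accepts (A ∩ B) (edgesOf (pt z)) := (scheme_val_eq_true_iff hr hs _ _).1 hinf
  have ha : (scheme m r s hr hs).val A (pt z) = true :=
    (scheme_val_eq_true_iff hr hs _ _).2 (hacc.mono inter_subset_left)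
  have hb : (scheme m r s hr hs).val B (pt z) = true :=
    (scheme_val_eq_true_iff hr hs _ _).2 (hacc.mono inter_subset_right)
  rw [ha, hb] at hab
  exact Bool.noConfusion hab

/-! ### Positive test inputs: perfect matchings -/

/-- The perfect matching `{(i, σ i)}` of a permutation `σ`, as an edge set (Jukna 2012, §9.11:
the random graph `E₊`, uniform on the `m!` perfect matchings). [cite: Jukna2012, §9.11 (PDF p. 292)] -/
def permGraph (σ : Equiv.Perm (Fin m)) : Finset (Edge m) := univ.filter fun e => σ e.1 = e.2

/-- The perfect matching of `σ` as an input of `f_m`. [cite: Jukna2012, §9.11 (PDF p. 292)] -/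
def permInput (σ : Equiv.Perm (Fin m)) : Edge m → Bool := fun e => decide (σ e.1 = e.2)

/-- Membership in `permGraph`. [folklore] -/
@[simp] theorem mem_permGraph {σ : Equiv.Perm (Fin m)} {e : Edge m} :
    e ∈ permGraph σ ↔ σ e.1 = e.2 := by
  simp [permGraph]

/-- The edge set of `permInput σ` is `permGraph σ`. [folklore] -/
@[simp] theorem edgesOf_permInput (σ : Equiv.Perm (Fin m)) : edgesOf (permInput σ) = permGraph σ := by
  ext e
  simp [permInput]

/-- A perfect matching is a matching. [folklore] -/
theorem isMatching_permGraph (σ : Equiv.Perm (Fin m)) : IsMatching (permGraph σ) := by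
  refine ⟨fun e₁ h₁ e₂ h₂ h => ?_, fun e₁ h₁ e₂ h₂ h => ?_⟩
  · rw [mem_permGraph] at h₁ h₂
    exact Prod.ext h (by rw [← h₁, ← h₂, h])
  · rw [mem_permGraph] at h₁ h₂
    refine Prod.ext (σ.injective ?_) h
    rw [h₁, h₂, h]

/-- **Perfect matchings through a given matching**: at most `(m - |E|)!` permutations contain
the matching `E` (exactly that many, in fact): restricting such a permutation to the vertices
not covered by `E` on the left gives an injection into the right vertices not covered by `E`,
and the permutation is recovered from this restriction (Jukna 2012, proof of Lemma 9.34, Case 3: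
"`Prob[E ⊆ E₊] = (m - |E|)!/m!`"). [cite: Jukna2012, Lemma 9.34] -/
theorem card_filter_supset_permGraph_le {E : Finset (Edge m)} (hE : IsMatching E) :
    #(univ.filter fun σ : Equiv.Perm (Fin m) => E ⊆ permGraph σ) ≤ (m - #E).factorial := by
  classical
  set I : Finset (Fin m) := E.image Prod.fst with hIdef
  set J : Finset (Fin m) := E.image Prod.snd with hJdef
  have hI : #I = #E := hE.card_image_fst
  have hJ : #J = #E := hE.card_image_snd
  -- values of a permutation containing `E`, off `I`, avoid `J`
  have key : ∀ σ : Equiv.Perm (Fin m), E ⊆ permGraph σ → ∀ x : Fin m, x ∈ Iᶜ → σ x ∈ Jᶜ := by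
    intro σ hσ x hx
    rw [mem_compl] at hx ⊢
    intro hJx
    obtain ⟨e, he, hex⟩ := mem_image.1 hJx
    have h1 : σ e.1 = e.2 := mem_permGraph.1 (hσ he)
    refine hx (mem_image.2 ⟨e, he, σ.injective ?_⟩)
    rw [h1, hex]
  have hT : Fintype.card (↥(Iᶜ) ↪ ↥(Jᶜ)) = (m - #E).factorial := by
    rw [Fintype.card_embedding_eq, Fintype.card_coe, Fintype.card_coe, card_compl, card_compl,
      Fintype.card_fin, hI, hJ, Nat.descFactorial_self]
  have hne : Nonempty (↥(Iᶜ) ↪ ↥(Jᶜ)) := Fintype.card_pos_iff.1 (hT ▸ Nat.factorial_pos _)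
  let F : Equiv.Perm (Fin m) → (↥(Iᶜ) ↪ ↥(Jᶜ)) := fun σ =>
    if h : E ⊆ permGraph σ then
      ⟨fun x => ⟨σ x, key σ h x x.2⟩, fun x y hxy =>
        Subtype.ext (σ.injective (congrArg Subtype.val hxy))⟩
    else hne.some
  rw [← hT, ← card_univ]
  refine card_le_card_of_injOn F (fun σ _ => mem_coe.2 (mem_univ _)) ?_
  intro σ hσ τ hτ hστ
  rw [mem_coe, mem_filter] at hσ hτ
  have hσ' := hσ.2
  have hτ' := hτ.2
  simp only [F, dif_pos hσ', dif_pos hτ'] at hστ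
  refine Equiv.ext fun x => ?_
  by_cases hx : x ∈ Iᶜ
  · have h := congrArg (fun f : ↥(Iᶜ) ↪ ↥(Jᶜ) => ((f ⟨x, hx⟩ : ↥(Jᶜ)) : Fin m)) hστ
    simpa using h
  · rw [mem_compl, not_not] at hx
    obtain ⟨e, he, rfl⟩ := mem_image.1 hx
    rw [mem_permGraph.1 (hσ' he), mem_permGraph.1 (hτ' he)]

/-! ### The positive error of an approximate meet (Jukna 2012, Lemma 9.34) -/

/-- **Jukna 2012, Lemma 9.34, counting form.** For `r`-closed `𝒜, ℬ ⊆ Per_s` (`r ≥ 2`), the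
perfect matchings accepted by `⌈𝒜⌉` and `⌈ℬ⌉` but not by `⌈𝒜 ∩ ℬ⌉` number at most
`((r-1)^s)^2 · (m - s - 1)!`: such a perfect matching contains `X ∪ Y` for minimal members
`X ∈ 𝒜`, `Y ∈ ℬ`; `X ∪ Y` is a matching (inside a perfect matching) not in `Per_s` (else it
would lie in `𝒜 ∩ ℬ`), so `|X ∪ Y| ≥ s + 1` and at most `(m - s - 1)!` perfect matchings contain
it; and there are at most `(r-1)^s · (r-1)^s` pairs `(X, Y)` (Lemma 9.32 in the Alon–Boppana
form). Jukna's printed bound: `Prob ≤ (s! rˢ)² (m-s-1)!/m!`. [cite: Jukna2012, Lemma 9.34] -/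
theorem card_posErr_le {r s : ℕ} (hr : 2 ≤ r) {A B : Finset (Finset (Edge m))}
    (hA : IsClosedIn r (Per m s) A) (hB : IsClosedIn r (Per m s) B) :
    #(univ.filter fun σ : Equiv.Perm (Fin m) =>
        Accepts A (permGraph σ) ∧ Accepts B (permGraph σ) ∧ ¬ Accepts (A ∩ B) (permGraph σ)) ≤
      ((r - 1) ^ s) ^ 2 * (m - (s + 1)).factorial := by
  classical
  set T := (minimals A ×ˢ minimals B).filter fun p => s < #(p.1 ∪ p.2) with hTdef
  have hcover : (univ.filter fun σ : Equiv.Perm (Fin m) =>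
        Accepts A (permGraph σ) ∧ Accepts B (permGraph σ) ∧ ¬ Accepts (A ∩ B) (permGraph σ)) ⊆
      T.biUnion fun p => univ.filter fun σ : Equiv.Perm (Fin m) => p.1 ∪ p.2 ⊆ permGraph σ := by
    intro σ hσ
    obtain ⟨-, ha, hb, hab⟩ := mem_filter.1 hσ
    obtain ⟨X, hX, Y, hY, hXY, hXYP⟩ := hA.exists_union_not_mem hB ha hb hab
    have hs : s < #(X ∪ Y) := by
      by_contra hle
      exact hXYP (mem_Per.2 ⟨(isMatching_permGraph σ).subset hXY, not_lt.1 hle⟩)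
    exact mem_biUnion.2 ⟨(X, Y), mem_filter.2 ⟨mem_product.2 ⟨hX, hY⟩, hs⟩,
      mem_filter.2 ⟨mem_univ _, hXY⟩⟩
  calc #(univ.filter fun σ : Equiv.Perm (Fin m) =>
          Accepts A (permGraph σ) ∧ Accepts B (permGraph σ) ∧ ¬ Accepts (A ∩ B) (permGraph σ))
      ≤ #(T.biUnion fun p => univ.filter fun σ : Equiv.Perm (Fin m) => p.1 ∪ p.2 ⊆ permGraph σ) :=
        card_le_card hcover
    _ ≤ ∑ p ∈ T, #(univ.filter fun σ : Equiv.Perm (Fin m) => p.1 ∪ p.2 ⊆ permGraph σ) :=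
        card_biUnion_le
    _ ≤ ∑ p ∈ T, (m - (s + 1)).factorial := by
        refine sum_le_sum fun p hp => ?_
        obtain ⟨-, hps⟩ := mem_filter.1 hp
        by_cases hM : IsMatching (p.1 ∪ p.2)
        · exact (card_filter_supset_permGraph_le hM).trans (Nat.factorial_le (by omega))
        · rw [filter_false_of_mem, card_empty]
          · exact Nat.zero_le _
          · intro σ _ hsub
            exact hM ((isMatching_permGraph σ).subset hsub)
    _ = #T * (m - (s + 1)).factorial := by rw [sum_const, smul_eq_mul]
    _ ≤ #(minimals A) * #(minimals B) * (m - (s + 1)).factorial := by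
        refine Nat.mul_le_mul_right _ ((card_filter_le _ _).trans ?_)
        rw [card_product]
    _ ≤ (r - 1) ^ s * (r - 1) ^ s * (m - (s + 1)).factorial :=
        Nat.mul_le_mul_right _ (Nat.mul_le_mul
          (hA.card_minimals_le Per_down card_le_of_mem_Per hr)
          (hB.card_minimals_le Per_down card_le_of_mem_Per hr))
    _ = ((r - 1) ^ s) ^ 2 * (m - (s + 1)).factorial := by rw [sq]

/-- **The positive error of the scheme**, in the form consumed by
`ApproxScheme.exists_approx_circuit` (unit weights on the `m!` perfect matchings): an approximate
AND loses at most `((r-1)^s)^2 (m-s-1)!` perfect matchings. [cite: Jukna2012, Lemma 9.34] -/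
theorem sum_lostInf_le {r s : ℕ} (hr : 2 ≤ r) (hs : 1 ≤ s) {A B : Finset (Finset (Edge m))}
    (hA : (scheme m r s hr hs).ok A) (hB : (scheme m r s hr hs).ok B) :
    ∑ _σ ∈ (scheme m r s hr hs).lostInf univ permInput A B, (1 : ℝ) ≤
      ((((r - 1) ^ s) ^ 2 * (m - (s + 1)).factorial : ℕ) : ℝ) := by
  classical
  rw [sum_const, nsmul_eq_mul, mul_one]
  have h := card_posErr_le hr hA hB
  refine le_trans ?_ (Nat.cast_le.2 h)
  refine Nat.cast_le.2 (card_le_card fun σ hσ => ?_)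
  obtain ⟨-, hab, hinf⟩ := mem_filter.1 hσ
  rw [Bool.and_eq_true, scheme_val_eq_true_iff, scheme_val_eq_true_iff, edgesOf_permInput] at hab
  refine mem_filter.2 ⟨mem_univ _, hab.1, hab.2, fun hacc => ?_⟩
  have : (scheme m r s hr hs).val ((scheme m r s hr hs).inf A B) (permInput σ) = true := by
    rw [scheme_val_eq_true_iff, edgesOf_permInput]
    exact hacc
  rw [this] at hinf
  exact Bool.noConfusion hinf

end PerfectMatching

end Literature.Computability.Complexity
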